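import Summits.AtomisticToContinuum.FouriersLaw.Theses.CoercivePulse
import Summits.AtomisticToContinuum.FouriersLaw.Theorems.CageBudgetFeketeHeatVarianceCalculus
import Summits.AtomisticToContinuum.FouriersLaw.Theorems.CageBudgetFeketeUnboundedHeatVarianceCurrentSpectralMeasure
import Summits.AtomisticToContinuum.FouriersLaw.Theorems.CageBudgetFeketeUnboundedHeatVarianceSpectralHeatVarianceUnbounded
import Summits.AtomisticToContinuum.FouriersLaw.Theorems.CageBudgetFeketeUnboundedHeatVarianceOfLinearSpread
import Summits.AtomisticToContinuum.FouriersLaw.Theorems.CoercivePulseLinearCeilingOfUniformAbelianRegularity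
import Summits.AtomisticToContinuum.FouriersLaw.Theorems.CoercivePulseLinearSpreadStubKaramataCollapse
import Summits.AtomisticToContinuum.FouriersLaw.Theorems.CoercivePulseLinearSpreadStubSpectralIncrements
import Summits.AtomisticToContinuum.FouriersLaw.Theorems.CoercivePulseLinearSpreadStubHelfandIdentity
import Summits.AtomisticToContinuum.FouriersLaw.Theorems.CoercivePulseLinearSpreadBridgeAbelData
import HarnessLib

/-!
# `CoercivePulse.LinearSpread` (stmt-AtomisticToContinuum-15382) from the two bridge children (R) and CLB — the certificate of line
# `KaramataCollapse` (`--supports` file: it closes nothing, it REDUCES the crux to the existing items stmt-13416 + stmt-11749)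

WHAT. `linearSpread_of_bridge : UniformAbelianRegularity → ConductanceLowerBound → LinearSpread` (hypotheses = the route decls
`CoercivePulse.UniformAbelianRegularity` (item stmt-13416) and `CoercivePulse.ConductanceLowerBound` (item stmt-11749), the two gen-1
children of the shared bridge `AbelThermodynamicLimit`, consumed by this route's `closes` through `AbelThermodynamicLimitGlueBy_holds`;
conclusion = the crux decl). With the landed converse `conductanceLowerBound_of_linearSpread` (p157637, modulo (R), `PulseCalculus`,
`SymmetricSetup`) this pins the route's rank-2 positivity crux to the shared positivity child: modulo (R), `LinearSpread ⟺ CLB`.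
Tenure planner: `route edit --split LinearSpread --into UniformAbelianRegularity ConductanceLowerBound --glue-by` this theorem, or
close-on-close.

HOW. The sorry-free composition of the registered skeleton `Cruxes/LinearSpread/Lines/KaramataCollapse.lean` over its five LANDED stubs
(`stub_karamataCollapse` p166369, `stub_spectralIncrements` p166798, `stub_helfandIdentity` p166976, `stub_abelRegularityOfRegularity` +
`stub_abelFloorOfBridge` p167641) and the landed `heatVarianceCalculus_proof`, `stub_currentSpectralMeasure`,
`heatVariance_eq_integral_hvKernel`, `linearCeiling_of_uniformAbelianRegularity`; plus the elementary Abelian lemma `io_of_abelFloor`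
(an Abel floor forces linear growth of the heat variance infinitely often) and the Fejér bound `spectralHeatVariance_le_sq`.
No definitions, no named facts. Lead prover-line-stmt-AtomisticToContinuum-15382-0, 2026-08-17 (cycle 1).
-/

noncomputable section

namespace Summit.AtomisticToContinuum.FouriersLaw.Theorems.LinearSpread.KaramataCollapse

open Filter Topology MeasureTheory Set
open Literature.MathematicalPhysics.KineticTheory.HeatConduction

/-- The Fejér bound on the spectral heat variance: `2∫_{(0,τ]}(τ−s)(∫cos(ωs)dρ)ds ≤ τ²·ρ(ℝ)` for `τ ≥ 0`
(`V = ∫ τ²sinc²(ωτ/2)dρ` and `sinc² ≤ 1`). [folklore] -/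
theorem spectralHeatVariance_le_sq (ρ : Measure ℝ) [IsFiniteMeasure ρ] {τ : ℝ} (hτ : 0 ≤ τ) :
    2 * ∫ s in Ioc (0:ℝ) τ, (τ - s) * (∫ w : ℝ, Real.cos (w * s) ∂ρ) ≤ τ ^ 2 * ρ.real univ := by
  rw [Summit.AtomisticToContinuum.FouriersLaw.Theorems.UnboundedHeatVariance.Birth.heatVariance_eq_integral_hvKernel ρ hτ]
  calc ∫ w, τ ^ 2 * Real.sinc (w * τ / 2) ^ 2 ∂ρ ≤ ∫ _w, τ ^ 2 ∂ρ :=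
        integral_mono (Summit.AtomisticToContinuum.FouriersLaw.Theorems.UnboundedHeatVariance.Birth.integrable_hvKernel ρ τ)
          (integrable_const _)
          fun w => Summit.AtomisticToContinuum.FouriersLaw.Theorems.UnboundedHeatVariance.Birth.hvKernel_le_sq w τ
    _ = τ ^ 2 * ρ.real univ := by rw [integral_const, smul_eq_mul, mul_comm]

/-- **Abelian lemma: an Abel floor forces linear growth infinitely often.** If `a ≤ A(ν)` for `ν ∈ (0,ν₀)` (`a > 0`), where
`A(ν) = (ν²/2)∫₀^∞e^{−νt}V(t)dt` with `e^{−νt}V` integrable on `(0,∞)`, and `V` is bounded above on every `[0,τ]`, then for every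
`t₀` there is `t ≥ t₀` with `a·t ≤ V(t)`. (Otherwise `V ≤ a·t + K` on `(0,∞)` and `A(ν) ≤ a/2 + Kν/2 < a` for small `ν`.)
[folklore; Hardy–Littlewood Abelian half] -/
theorem io_of_abelFloor (V A : ℝ → ℝ) {a ν₀ : ℝ} (ha : 0 < a) (hν₀ : 0 < ν₀)
    (hfloor : ∀ ν : ℝ, 0 < ν → ν < ν₀ → a ≤ A ν)
    (hLap : ∀ ν : ℝ, 0 < ν → IntegrableOn (fun t : ℝ => Real.exp (-(ν * t)) * V t) (Ioi 0) ∧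
      A ν = ν ^ 2 / 2 * ∫ t in Ioi (0:ℝ), Real.exp (-(ν * t)) * V t)
    (hloc : ∀ τ : ℝ, 0 ≤ τ → ∃ K : ℝ, ∀ t : ℝ, 0 ≤ t → t ≤ τ → V t ≤ K) :
    ∀ t₀ : ℝ, ∃ t : ℝ, t₀ ≤ t ∧ a * t ≤ V t := by
  intro t₀
  by_contra hcon
  push Not at hcon
  -- a global affine majorant `V t ≤ a t + K'` on `(0, ∞)`
  obtain ⟨K, hK⟩ := hloc (max t₀ 0) (le_max_right _ _)
  set K' : ℝ := max K 0 with hK'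
  have hK'0 : 0 ≤ K' := le_max_right _ _
  have hmaj : ∀ t : ℝ, 0 < t → V t ≤ a * t + K' := by
    intro t ht
    rcases le_or_gt t (max t₀ 0) with h1 | h1
    · have := hK t ht.le h1
      nlinarith [le_max_left K 0, mul_pos ha ht]
    · have := hcon t ((le_max_left _ _).trans h1.le)
      linarith
  -- hence `A ν ≤ a/2 + K' ν / 2` for every `ν > 0`
  have hAle : ∀ ν : ℝ, 0 < ν → A ν ≤ a / 2 + K' / 2 * ν := by
    intro ν hν
    obtain ⟨hiV, hAν⟩ := hLap ν hν
    obtain ⟨hiA, hvA⟩ :=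
      Summit.AtomisticToContinuum.FouriersLaw.Theorems.UnboundedHeatVariance.Birth.integral_exp_neg_mul_affine hν a K'
    have hmono : ∫ t in Ioi (0:ℝ), Real.exp (-(ν * t)) * V t ≤ ∫ t in Ioi (0:ℝ), Real.exp (-(ν * t)) * (a * t + K') :=
      setIntegral_mono_on hiV hiA measurableSet_Ioi fun t ht =>
        mul_le_mul_of_nonneg_left (hmaj t ht) (Real.exp_pos _).le
    rw [hvA] at hmono
    have hν2 : 0 ≤ ν ^ 2 / 2 := by positivity
    have h := mul_le_mul_of_nonneg_left hmono hν2
    have e : ν ^ 2 / 2 * (a * (ν ^ 2)⁻¹ + K' * ν⁻¹) = a / 2 + K' / 2 * ν := by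
      field_simp
    rw [hAν]
    linarith [h, e.symm.le, e.le]
  -- contradiction at a small frequency
  set ν : ℝ := min (ν₀ / 2) (a / (K' + 1)) with hνdef
  have hK1 : 0 < K' + 1 := by linarith
  have hνpos : 0 < ν := lt_min (by positivity) (div_pos ha hK1)
  have hνlt : ν < ν₀ := (min_le_left _ _).trans_lt (by linarith)
  have hνle : ν ≤ a / (K' + 1) := min_le_right _ _
  have h1 := hfloor ν hνpos hνlt
  have h2 := hAle ν hνpos
  have h3 : K' * ν ≤ K' * (a / (K' + 1)) := mul_le_mul_of_nonneg_left hνle hK'0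
  have h4 : K' * (a / (K' + 1)) < a := by
    rw [mul_div_assoc', div_lt_iff₀ hK1]
    nlinarith
  linarith

/-- **`LinearSpread` is downstream of the two bridge children: `UniformAbelianRegularity → ConductanceLowerBound → LinearSpread`.**
For the pinned anharmonic chain (`ω₂, lam, β > 0`), N-uniform Abelian regularity of the open chain's equilibrium current autocorrelation
((R), item stmt-AtomisticToContinuum-13416) and an Ohmic lower bound on the open chain's response coefficients (CLB, item
stmt-AtomisticToContinuum-11749) imply the DIFFUSIVE LOWER ENVELOPE OF THE HELFAND MOMENT of the averaged equilibrium energy pulse for every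
guarded pair (`CoercivePulse.LinearSpread`, item stmt-AtomisticToContinuum-15382): `m·t ≤ M(t)` for `t ≥ t₂`, `m > 0`. Proof = the
composition of line `KaramataCollapse` over its five landed stubs: heat-variance calculus and the Helfand–Bochner measure (landed) put
`V = M − M(0)` (Helfand, `stub_helfandIdentity`) in spectral form with the increment bound (`stub_spectralIncrements`) and `V ≤ τ²ρ(ℝ)`;
(R) gives the ceiling (`linearCeiling_of_uniformAbelianRegularity`) and the regularity (`stub_abelRegularityOfRegularity`); (R) + CLB give
an Abel floor (`stub_abelFloorOfBridge`), hence `V ≥ a·t` infinitely often (`io_of_abelFloor`); the Karamata collapse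
(`stub_karamataCollapse`) makes it `V ≥ m·t` eventually. [cite: BonettoLebowitzReyBellet2000, §7] [cite: Helfand1960, §II] -/
theorem linearSpread_of_bridge : Summit.AtomisticToContinuum.FouriersLaw.Theses.CoercivePulse.UniformAbelianRegularity → Summit.AtomisticToContinuum.FouriersLaw.Theses.CoercivePulse.ConductanceLowerBound → Summit.AtomisticToContinuum.FouriersLaw.Theses.CoercivePulse.LinearSpread := by
  intro hR hC
  have hAR := stub_abelRegularityOfRegularity
  have hF := stub_abelFloorOfBridge
  have hK := stub_karamataCollapse
  have hI := stub_spectralIncrements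
  have hH := stub_helfandIdentity
  intro ω₂ lam β γ hω hl hβ T hT μ hG hSI hRefl D hP hShift h hh S hS hSum
  -- the landed heat-variance calculus of the guarded pair
  obtain ⟨hAC, hCc, hVc⟩ :=
    Summit.AtomisticToContinuum.FouriersLaw.Theorems.HeatVarianceCalculus.CanonicalRigidity.heatVarianceCalculus_proof
      ω₂ lam β γ hω hl hβ T hT μ hG hSI hRefl D hP hShift
  obtain ⟨V, hV⟩ : ∃ V : ℝ → ℝ, V = (fun τ : ℝ => 2 * ∫ s in Set.Ioc (0:ℝ) τ, (τ - s) * D.currentCorrelation μ s) :=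
    ⟨_, rfl⟩
  obtain ⟨hV0, hLap⟩ := hVc V hV
  -- the landed Helfand–Bochner spectral measure of the current
  obtain ⟨ρ, hρ, hrep⟩ :=
    Summit.AtomisticToContinuum.FouriersLaw.Theorems.UnboundedHeatVariance.Birth.stub_currentSpectralMeasure
      ω₂ lam β γ hω hl hβ T hT μ hG hSI hRefl D hP hShift hAC hCc
  haveI := hρ
  obtain ⟨W, hW⟩ : ∃ W : ℝ → ℝ,
      W = (fun τ : ℝ => 2 * ∫ s in Set.Ioc (0:ℝ) τ, (τ - s) * ∫ w : ℝ, Real.cos (w * s) ∂ρ) := ⟨_, rfl⟩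
  have hVW : ∀ τ : ℝ, 0 ≤ τ → V τ = W τ := fun τ _ => by
    rw [hV, hW]
    simp only
    congr 1
    refine setIntegral_congr_fun measurableSet_Ioc fun s hs => ?_
    rw [hrep s hs.1.le]
  have hWsq : ∀ τ : ℝ, 0 ≤ τ → V τ ≤ τ ^ 2 * ρ.real univ := fun τ hτ => by
    rw [hVW τ hτ, hW]; exact spectralHeatVariance_le_sq ρ hτ
  -- the Helfand moment and Helfand's identity (stub 3)
  obtain ⟨M, hM⟩ : ∃ M : ℝ → ℝ, M = (fun t : ℝ => ∑' x : ℤ, (x : ℝ) ^ 2 * S x t) := ⟨_, rfl⟩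
  have hHelf : ∀ t : ℝ, 0 ≤ t → M t - M 0 = V t := fun t ht => by
    rw [hM, hV]; exact hH ω₂ lam β γ hω hl hβ T hT μ hG hSI hRefl D hP hShift h hh S hS hSum t ht
  -- increments (stub 2) for `σ = √V`
  have hincr : ∀ s t : ℝ, 0 ≤ s → s ≤ t → |Real.sqrt (V t) - Real.sqrt (V s)| ≤ Real.sqrt (V (t - s)) := by
    intro s t hs hst
    rw [hVW t (hs.trans hst), hVW s hs, hVW (t - s) (sub_nonneg.mpr hst)]
    exact hI ρ hρ W hW s t hs hst
  -- ceiling: (R) ⇒ LinearCeiling (landed), moved to `V` by Helfand; `V ≤ τ²ρ(ℝ)` on `[0, t₃]`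
  have hceil : ∃ b : ℝ, ∀ t : ℝ, 0 ≤ t → V t ≤ b * (1 + t) := by
    obtain ⟨b, t₃, hup⟩ :=
      Summit.AtomisticToContinuum.FouriersLaw.Theorems.LinearCeiling.SpikeLemma.linearCeiling_of_uniformAbelianRegularity hR
        ω₂ lam β γ hω hl hβ T hT μ hG hSI hRefl D hP hShift h hh S hS hSum
    have hup' : ∀ t : ℝ, t₃ ≤ t → M t ≤ M t₃ + b * (t - t₃) := fun t ht => by
      have := hup t ht; rw [hM]; exact this
    set T₃ : ℝ := max t₃ 0 with hT₃
    refine ⟨|M t₃ - M 0| + |b| * |t₃| + |b| + T₃ ^ 2 * ρ.real univ, fun t ht => ?_⟩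
    have hρ0 : 0 ≤ T₃ ^ 2 * ρ.real univ := by positivity
    rcases le_or_gt T₃ t with hTt | hTt
    · have e1 := hup' t ((le_max_left _ _).trans hTt)
      have e2 : b * (t - t₃) ≤ |b| * t + |b| * |t₃| := by
        have := le_abs_self (b * (t - t₃)); have := abs_sub (b * t) (b * t₃)
        rw [mul_sub] at *; rw [abs_mul, abs_mul, abs_of_nonneg ht] at *
        nlinarith [abs_nonneg b, abs_nonneg t₃]
      rw [← hHelf t ht]
      nlinarith [le_abs_self (M t₃ - M 0), abs_nonneg (M t₃ - M 0), abs_nonneg b, abs_nonneg t₃,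
        mul_nonneg (abs_nonneg b) ht]
    · have e1 := hWsq t ht
      have e2 : t ^ 2 * ρ.real univ ≤ T₃ ^ 2 * ρ.real univ :=
        mul_le_mul_of_nonneg_right (pow_le_pow_left₀ ht hTt.le 2) measureReal_nonneg
      nlinarith [abs_nonneg (M t₃ - M 0), abs_nonneg b, abs_nonneg t₃, mul_nonneg (abs_nonneg b) ht,
        mul_nonneg (abs_nonneg b) (abs_nonneg t₃), mul_nonneg hρ0 ht]
  -- regularity: (R) ⇒ AbelRegularity (stub 6), transported to `ν²∫e^{−νt}V = 2Â(ν)` by the landed Laplace identity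
  have habel : (∃ L : ℝ, Tendsto (fun ν : ℝ => ν ^ 2 * ∫ t in Set.Ioi (0:ℝ), Real.exp (-(ν * t)) * V t)
        (𝓝[>] 0) (𝓝 L)) ∨
      Tendsto (fun ν : ℝ => ν ^ 2 * ∫ t in Set.Ioi (0:ℝ), Real.exp (-(ν * t)) * V t) (𝓝[>] 0) atTop := by
    have hreg := hAR hR ω₂ lam β γ hω hl hβ T hT μ hG hSI hRefl D hP hShift hAC (fun ν hν => (hLap ν hν).1)
    have heq : (fun ν : ℝ => ν ^ 2 * ∫ t in Set.Ioi (0:ℝ), Real.exp (-(ν * t)) * V t) =ᶠ[𝓝[>] 0]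
        fun ν : ℝ => 2 * ∫ t in Set.Ioi (0:ℝ), Real.exp (-(ν * t)) * D.currentCorrelation μ t := by
      filter_upwards [self_mem_nhdsWithin] with ν hν
      rw [(hLap ν hν).2.2]
      field_simp [(ne_of_gt (show (0:ℝ) < ν from hν))]
    rcases hreg with ⟨L, hL⟩ | htop
    · exact Or.inl ⟨2 * L, (hL.const_mul 2).congr' heq.symm⟩
    · exact Or.inr ((htop.const_mul_atTop two_pos).congr' heq.symm)
  -- floor: (R) + CLB ⇒ Abel floor (stub 7), hence linear growth of `V` infinitely often
  have hioV : ∃ m₁ : ℝ, 0 < m₁ ∧ ∀ t₀ : ℝ, ∃ t : ℝ, t₀ ≤ t ∧ m₁ * t ≤ V t := by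
    obtain ⟨a, ν₀, ha, hν₀, hfloor⟩ := hF hR hC ω₂ lam β γ hω hl hβ T hT μ hG hSI hRefl D hP
    refine ⟨a, ha, io_of_abelFloor V (fun ν => ∫ t in Set.Ioi (0:ℝ), Real.exp (-(ν * t)) * D.currentCorrelation μ t)
      ha hν₀ hfloor (fun ν hν => ⟨(hLap ν hν).2.1, (hLap ν hν).2.2⟩) fun τ hτ => ?_⟩
    exact ⟨τ ^ 2 * ρ.real univ, fun t ht htτ =>
      (hWsq t ht).trans (mul_le_mul_of_nonneg_right (pow_le_pow_left₀ ht htτ 2) measureReal_nonneg)⟩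
  -- Karamata collapse (stub 1) for `f = V`, `σ = √V`
  obtain ⟨m, t₂, hm, hlow⟩ := hK V (fun t => Real.sqrt (V t)) (fun t _ => Real.sqrt_nonneg _) hincr
    (fun t ht => (Real.sq_sqrt (hV0 t ht)).symm) hceil (fun ν hν => (hLap ν hν).2.1) habel hioV
  -- back to the Helfand moment
  refine ⟨m / 2, max (max t₂ 0) (2 * |M 0| / m), by positivity, fun t ht => ?_⟩
  have ht0 : 0 ≤ t := (le_max_right _ _).trans ((le_max_left _ _).trans ht)
  have ht2 : t₂ ≤ t := (le_max_left _ _).trans ((le_max_left _ _).trans ht)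
  have ht1 : 2 * |M 0| / m ≤ t := (le_max_right _ _).trans ht
  have h2 : 2 * |M 0| ≤ m * t := by
    have := (div_le_iff₀ hm).1 ht1; linarith [mul_comm t m]
  have hVt := hlow t ht2
  have hMe : (∑' x : ℤ, (x : ℝ) ^ 2 * S x t) = M 0 + V t := by
    rw [← hHelf t ht0, hM]; ring
  rw [hMe]
  linarith [neg_abs_le (M 0)]


end Summit.AtomisticToContinuum.FouriersLaw.Theorems.LinearSpread.KaramataCollapse

end
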